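import Summits.Ventures.HSemireg.FormulaNUniform
import HarnessLib

/-!
# Venture HSemireg — the THETA-DIVISOR PROFILE `dim Ext^k(i_*L, i_*L) ≤ h^k(𝒪_D) + h^{k-1}(N_D) = r_k(n) = [t^k]P_n(t)`,
# EVERY `n`, EVERY `k`, as a KERNEL dimension chase over long exact sequences taken BY VALUE

HONEST FRAMING. Lean index of the computation cell `pub-hsemireg` (seat p8, «Sunday typer § g = 6»; eleventh file of the seat,
successor of `MethodInstanceG6ExtremalFactors.lean`, which took the FACTOR WINDOWS «`(e₀, e₁, e₂) ≤ (1, 2n, n(n-1))`» of the g = 6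
certificate BY VALUE). Nothing about any explicit variety, divisor, sheaf, cohomology group or `Ext` group is asserted in the tree:
the carriers below are ABSTRACT finite-dimensional vector spaces over a field `K` with linear maps between them, and every theorem is
an implication «these maps are exact at the named spots ∧ these spaces have the named dimensions ⟹ those spaces obey those bounds».
Nothing here says HC, HC_CM or HC_AV is proved. No `def`, no `sorry`, no new named fact; imports `FormulaNUniform` only.

WHAT IS TYPED — theory seat 7's PART B §B.3 (`theory/FORMULA-N-th7.md` v1.7zz25 §B.3, tier «PROVED (seat derivation)», quoted):
«B.3 PROPOSITION (PROVED; the theta-divisor profile, all n). X a ppav of dim n ≥ 2, D ∈ |Θ| ANY theta divisor (h⁰(O(Θ)) = 1), L a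
line bundle on D, 𝓕 = i_*L. Then the local-to-global upper bound is dim Ext^k(𝓕,𝓕) ≤ h^k(O_D) + h^{k−1}(N_D) = C(n,k)[k≤n−1] + C(n,k)[k≥1]
= r_k(n) = [t^k]P_n — the SAME polynomial as I_p. (R𝓗om(i_*L,i_*L) has cohomology sheaves i_*O_D (deg 0), i_*N_D (deg 1), D Cartier;
h^k(O_D) = C(n,k) for k ≤ n−1 and 0 for k = n from 0→O(−Θ)→O→O_D→0 with H^•(O(−Θ)) = ℂ[−n] and H^n(O(−Θ)) → H^n(O) onto; h^k(N_D) =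
h^{k+1}(O_X) = C(n,k+1) from 0→O→O(Θ)→N_D→0 with H^•(O(Θ)) = ℂ[0].)» («p1's (S3) count (1, ≤6, ≤6, 1) is the case n = 3.») — i.e.
STRUCTURE.md v1.0-SIGNED §2 (S2)'s «Lemma route pins `(e₀,e₁,e₂) = (1, 2n, n(n−1)) = (r₀, r₁, r₂)` at every `n`» as an UPPER bound, and
the census's factor cells «`dim Ext^k(𝓕_m,𝓕_m) ≤ Σ_{p+q=k} h^p(D, Λ^q N_D) = (1, 3+3, 3+3)`» of the g = 6 theta-secant method instance
(`target-g6/CENSUS.md` v3.75 rows D-2…D-6; `step0/THETA-SECANT-p1.md` v2.6 §2 (S3); `𝓕_m = i_*𝒪_D(m·C_p)`, `D = Θ ⊂ J(C)`) — previously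
BINDERS of `MethodInstanceG6ExtremalFactors.extRank_le_boxRank_of_kunneth_of_window` — now DERIVED in the kernel from:

BY VALUE (hypotheses; the tree has no sheaf cohomology of `𝒪_X(±Θ)`, `𝒪_D`, `N_D` on these objects):
* (V1) `h^k(X, 𝒪_X) = C(n,k)` — `H^q(𝒪_X) ≅ Λ^q Ω̄` for a complex torus of dimension `n` [Lange2023AbelianVarietiesComplex, Thm. 1.1.21 (b)];
* (V2) `h^k(X, 𝒪_X(Θ)) = [k = 0]` — `Θ` principal: index `0`, `χ = 1` (Mumford's index theorem + Riemann–Roch)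
  [Lange2023AbelianVarietiesComplex, Cor. 1.6.5 and Thm. 1.7.1] [MumfordAV1970, §16];
* (V3) `h^k(X, 𝒪_X(−Θ)) = [k = n]` — index `n`, `χ = (−1)ⁿ` (same sources);
* (V4) `h^k(D, 𝒪_D) = 0` for `k ≥ n` — `dim D = n − 1`, Grothendieck(–Scheiderer) vanishing [GortzWedhorn2023, Thm. 21.57];
* (E1)/(E2) the cohomology sequences of `0 → 𝒪_X(−Θ) → 𝒪_X → 𝒪_D → 0` and `0 → 𝒪_X → 𝒪_X(Θ) → N_D → 0` (`N_D = 𝒪_D(D)`, `D` Cartier),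
  as families of linear maps with exactness at the spots the proof uses;
* (E3) the LOCAL-TO-GLOBAL sequence `… → H^k(𝒪_D) → Ext^k_X(i_*L,i_*L) → H^{k−1}(N_D) → H^{k+1}(𝒪_D) → …` — the two-row `E₂` page
  `E₂^{p,q} = H^p(X, 𝓔xt^q(i_*L,i_*L))`, `𝓔xt⁰ = i_*𝒪_D`, `𝓔xt¹ = i_*N_D`, `𝓔xt^{≥2} = 0` (`L` invertible, `D` Cartier) [GortzWedhorn2023,
  Cor. 21.108], spliced as usual for two adjacent rows; only its edge maps and exactness AT `Ext` enter (what an UPPER bound uses).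
KERNEL (this file): the dimension chase. §0 linear algebra of an exact spot + the profile arithmetic, incl. the IDENTIFICATION
«`[t^k]P_n(t) = h^k(𝒪_D) + h^{k−1}(N_D)`», i.e. `P_n(t) = ((1+t)ⁿ − tⁿ) + ((1+t)ⁿ − 1)` = the Poincaré polynomial of `H^•(D,𝒪_D) ⊕
H^{•−1}(D,N_D)` (STRUCTURE §1.0 D8's polynomial READ OFF a theta divisor); §1 `h^k(𝒪_D) = C(n,k)` (`k < n`) from
(E1)+(V1)+(V3)+(V4); §2 `h^k(N_D) = C(n,k+1)` (all `k`) from (E2)+(V1)+(V2); §3 the window from (E3); §4 THE PROFILE `dim Ext^k ≤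
transversePairRank n k` (th-6's `r_k(n) = 2C(n,k) − [k=0] − [k=n]` = seat p10's `[t^k]P_n`) for EVERY `n ≥ 1` and EVERY `k`, `Ext⁰` a
line, `Ext^k = 0` for `k > n`; §5 the numerals of record — `n = 3`: `(h^•(𝒪_D); h^•(N_D)) = (1,3,3; 3,3,1)`, window `(1, 3+3, 3+3,
0+1) = (1,6,6,1)` (g = 6, rows D-2…D-6); `n = 2`: `(1, 2+2, 0+1) = (1,4,1)` (genus-2 theta divisor = the g = 4 anchor's profile) — and
the KÜNNETH box of two theta-divisor factors `dim Ext²(F₁ ⊠ F₂) ≤ boxRank n 2` (`= 1·6 + 6·6 + 6·1 = 48` at `n = 3`, the OBJECT side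
of «rank 48 = bound 48»), Künneth identity BY VALUE as in the predecessor file.
WHAT IS NOT HERE: equality (EXTREMALITY `e_k = r_k`, th-7 §B.4 — needs the class side / the vanishing of `d₂`; at `n = 3` it is the
census's computed `dim Ext² = 48` and the predecessor's `…Converse.lean`); smoothness of `D` is NOT used (th-7 (b): Cartier suffices);
the `I_p` profile (th-7 §B.2); any statement about a Weil class. 0 `def`, 0 `sorry`, 0 new named fact.
Sources: `theory/FORMULA-N-th7.md` §B.3/§B.4; `general-structure/STRUCTURE.md` v1.0-SIGNED (`9b196a05977dd067`) §1.0 D8, §2 (S2);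
`target-g6/CENSUS.md` v3.75 D-2…D-6; `target-g6/VERDICT-G6.md` v1.0 (`1651dcc7322662a2`) V-4; [Lange2023AbelianVarietiesComplex]
Thm. 1.1.21, Cor. 1.6.5, Thm. 1.7.1/1.7.3; [MumfordAV1970] §16; [GortzWedhorn2023] Thm. 21.57, Cor. 21.108; [Markman2025SecantWeil]
Lemma 8.3.2 (the `(1,6,6,1)^G` profile at `n = 3`, preprint).
-/

open Module Polynomial Finset
namespace Summit.Ventures.HSemireg
open FormulaN (transversePairRank)
open FormulaN.Uniform (P boxRank coeff_P)
namespace ThetaDivisorWindow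

/-! ## §0 Linear algebra of an exact spot, and the profile arithmetic -/

section LinearAlgebra

variable {K : Type*} [DivisionRing K] {U V W : Type*} [AddCommGroup U] [Module K U] [AddCommGroup V] [Module K V]
  [AddCommGroup W] [Module K W]

/-- At an exact spot `U → V → W` (`range f = ker g`): `dim V = rank f + rank g`. [bookkeeping] -/
theorem finrank_eq_rank_add_rank_of_exact [FiniteDimensional K V] (f : U →ₗ[K] V) (g : V →ₗ[K] W)
    (h : LinearMap.range f = LinearMap.ker g) :
    finrank K V = finrank K (LinearMap.range f) + finrank K (LinearMap.range g) := by
  have := LinearMap.finrank_range_add_finrank_ker g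
  rw [← h] at this
  omega

/-- At an exact spot `U → V → W`: `dim V ≤ dim U + dim W`. [bookkeeping] -/
theorem finrank_mid_le_of_exact [FiniteDimensional K U] [FiniteDimensional K V] [FiniteDimensional K W]
    (f : U →ₗ[K] V) (g : V →ₗ[K] W) (h : LinearMap.range f = LinearMap.ker g) :
    finrank K V ≤ finrank K U + finrank K W := by
  have h₁ := finrank_eq_rank_add_rank_of_exact f g h
  have h₂ : finrank K (LinearMap.range f) ≤ finrank K U := LinearMap.finrank_range_le f
  have h₃ : finrank K (LinearMap.range g) ≤ finrank K W := Submodule.finrank_le _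
  omega

/-- An injective map with `range = ⊤` between finite-dimensional spaces preserves `dim`. [bookkeeping] -/
theorem finrank_eq_of_ker_eq_bot_of_range_eq_top [FiniteDimensional K U] [FiniteDimensional K V] (f : U →ₗ[K] V)
    (h₁ : LinearMap.ker f = ⊥) (h₂ : LinearMap.range f = ⊤) : finrank K V = finrank K U := by
  rw [← LinearMap.finrank_range_of_inj (LinearMap.ker_eq_bot.mp h₁), h₂, finrank_top]

end LinearAlgebra

/-- th-6's `r_k(n) = 2C(n,k) − [k=0] − [k=n]` SPLIT as «`h^k(𝒪_D) + h^{k−1}(N_D)`»: `[k < n]·C(n,k) + [1 ≤ k]·C(n,k)`, all `n, k`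
(th-7 §B.3: «`= C(n,k)[k≤n−1] + C(n,k)[k≥1] = r_k(n)`»). [bookkeeping] -/
theorem transversePairRank_eq_structure_add_normal (n k : ℕ) :
    transversePairRank n k = (if k < n then n.choose k else 0) + (if k = 0 then 0 else n.choose k) := by
  unfold transversePairRank
  rcases Nat.lt_trichotomy k n with hk | hkn | hk
  · rw [if_pos hk, if_neg (show k ≠ n by omega)]
    rcases Nat.eq_zero_or_pos k with h0 | h0
    · rw [if_pos h0, if_pos h0, h0, Nat.choose_zero_right]
    · rw [if_neg (show k ≠ 0 by omega), if_neg (show k ≠ 0 by omega)]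
      omega
  · have h₁ : n.choose k = 1 := by rw [hkn, Nat.choose_self]
    rw [if_neg (show ¬ k < n by omega), if_pos hkn, h₁]
    rcases Nat.eq_zero_or_pos k with h0 | h0
    · rw [if_pos h0, if_pos h0]
    · rw [if_neg (show k ≠ 0 by omega), if_neg (show k ≠ 0 by omega)]
  · rw [if_neg (show ¬ k < n by omega), if_neg (show k ≠ n by omega), if_neg (show k ≠ 0 by omega),
      if_neg (show k ≠ 0 by omega), Nat.choose_eq_zero_of_lt hk]

/-- The structure-sheaf summand: `[t^k]((1+t)ⁿ − tⁿ) = [k < n]·C(n,k)` (`= h^k(𝒪_D)`, §1). [bookkeeping] -/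
theorem coeff_structurePoly (n k : ℕ) :
    ((1 + X) ^ n - X ^ n : ℤ[X]).coeff k = if k < n then (n.choose k : ℤ) else 0 := by
  rw [coeff_sub, add_comm (1 : ℤ[X]) X, coeff_X_add_one_pow, coeff_X_pow]
  rcases Nat.lt_trichotomy k n with hk | hkn | hk
  · rw [if_neg (show k ≠ n by omega), if_pos hk, sub_zero]
  · rw [if_pos hkn, if_neg (show ¬ k < n by omega), hkn, Nat.choose_self, Nat.cast_one, sub_self]
  · rw [if_neg (show k ≠ n by omega), if_neg (show ¬ k < n by omega), Nat.choose_eq_zero_of_lt hk, Nat.cast_zero,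
      sub_zero]

/-- The normal-sheaf summand: `[t^k]((1+t)ⁿ − 1) = [1 ≤ k]·C(n,k)` (`= h^{k−1}(N_D)`, §2). [bookkeeping] -/
theorem coeff_normalPoly (n k : ℕ) :
    ((1 + X) ^ n - 1 : ℤ[X]).coeff k = if k = 0 then 0 else (n.choose k : ℤ) := by
  rw [coeff_sub, add_comm (1 : ℤ[X]) X, coeff_X_add_one_pow, coeff_one]
  rcases Nat.eq_zero_or_pos k with h0 | h0
  · rw [if_pos h0, if_pos h0, h0, Nat.choose_zero_right, Nat.cast_one, sub_self]
  · rw [if_neg (show k ≠ 0 by omega), if_neg (show k ≠ 0 by omega), sub_zero]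

/-- **IDENTIFICATION of STRUCTURE §1.0 D8's polynomial: `P_n(t) = ((1+t)ⁿ − tⁿ) + ((1+t)ⁿ − 1)`** — the Poincaré polynomial of
`H^•(D, 𝒪_D) ⊕ H^{•−1}(D, N_D)` for ANY theta divisor `D` of ANY p.p. abelian `n`-fold (§1, §2 supply the two Poincaré polynomials
from the by-value inputs) — «the SAME polynomial as `I_p`» (th-7 §B.3). [bookkeeping] -/
theorem P_eq_structurePoly_add_normalPoly (n : ℕ) : P n = ((1 + X) ^ n - X ^ n) + ((1 + X) ^ n - 1) := by
  rw [P]; ring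

/-- Coefficientwise: `[t^k]P_n = [k < n]·C(n,k) + [1 ≤ k]·C(n,k)` (= `h^k(𝒪_D) + h^{k−1}(N_D)`). [bookkeeping] -/
theorem coeff_P_eq_structure_add_normal (n k : ℕ) :
    (P n).coeff k = (if k < n then (n.choose k : ℤ) else 0) + (if k = 0 then 0 else (n.choose k : ℤ)) := by
  rw [P_eq_structurePoly_add_normalPoly, coeff_add, coeff_structurePoly, coeff_normalPoly]

section Cohomology

variable {K : Type*} [Field K]

/-! ## §1 `h^k(𝒪_D) = C(n,k)` for `k < n`, from `0 → 𝒪_X(−Θ) → 𝒪_X → 𝒪_D → 0` -/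

section StructureSheaf

variable {HXm HX HD : ℕ → Type*} [∀ k, AddCommGroup (HXm k)] [∀ k, Module K (HXm k)] [∀ k, FiniteDimensional K (HXm k)]
  [∀ k, AddCommGroup (HX k)] [∀ k, Module K (HX k)] [∀ k, FiniteDimensional K (HX k)]
  [∀ k, AddCommGroup (HD k)] [∀ k, Module K (HD k)] [∀ k, FiniteDimensional K (HD k)]

/-- **`h^k(𝒪_D) = C(n,k)` for every `k < n`** (th-7 §B.3, first count). Carriers BY VALUE: `HXm k`, `HX k`, `HD k` stand for
`H^k(X, 𝒪_X(−Θ))`, `H^k(X, 𝒪_X)`, `H^k(D, 𝒪_D)`; `a k`, `b k`, `c k` for the maps of the cohomology sequence of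
`0 → 𝒪_X(−Θ) → 𝒪_X → 𝒪_D → 0`, exact at `HX k` (`hB`), `HD k` (`hC`), `HXm (k+1)` (`hA`); dimensions (V3) `dim HXm k = [k = n]`,
(V1) `dim HX k = C(n,k)`, (V4) `dim HD k = 0` for `k ≥ n`. Chase: `HXm k = 0` kills `a k`; `c k` lands in `HXm (k+1)`, zero unless
`k + 1 = n`, where `a n` is onto the line `HX n` because `HD n = 0` («`H^n(O(−Θ)) → H^n(O)` onto») — so `c k = 0` either way.
[cite: Lange2023AbelianVarietiesComplex, Thm. 1.1.21 (b), Cor. 1.6.5, Thm. 1.7.1] [cite: GortzWedhorn2023, Thm. 21.57] -/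
theorem finrank_structureSheaf_eq_choose {n : ℕ} (a : ∀ k, HXm k →ₗ[K] HX k) (b : ∀ k, HX k →ₗ[K] HD k)
    (c : ∀ k, HD k →ₗ[K] HXm (k + 1)) (hB : ∀ k, LinearMap.range (a k) = LinearMap.ker (b k))
    (hC : ∀ k, LinearMap.range (b k) = LinearMap.ker (c k)) (hA : ∀ k, LinearMap.range (c k) = LinearMap.ker (a (k + 1)))
    (hXm : ∀ k, finrank K (HXm k) = if k = n then 1 else 0) (hX : ∀ k, finrank K (HX k) = n.choose k)
    (hDtop : ∀ k, n ≤ k → finrank K (HD k) = 0) {k : ℕ} (hk : k < n) : finrank K (HD k) = n.choose k := by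
  -- rank bookkeeping at the spots `HX k`, `HD k`, `HXm (k+1)`, `HX (k+1)`
  have eB := finrank_eq_rank_add_rank_of_exact (a k) (b k) (hB k)
  have eC := finrank_eq_rank_add_rank_of_exact (b k) (c k) (hC k)
  have eA := finrank_eq_rank_add_rank_of_exact (c k) (a (k + 1)) (hA k)
  have eB' := finrank_eq_rank_add_rank_of_exact (a (k + 1)) (b (k + 1)) (hB (k + 1))
  have ra : finrank K (LinearMap.range (a k)) ≤ finrank K (HXm k) := LinearMap.finrank_range_le _
  have rb' : finrank K (LinearMap.range (b (k + 1))) ≤ finrank K (HD (k + 1)) := Submodule.finrank_le _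
  have hXmk := hXm k
  have hXmk1 := hXm (k + 1)
  have hXk := hX k
  have hXk1 := hX (k + 1)
  rw [if_neg (show k ≠ n by omega)] at hXmk
  by_cases hkn : k + 1 = n
  · rw [if_pos hkn] at hXmk1
    have hD1 : finrank K (HD (k + 1)) = 0 := hDtop (k + 1) (by omega)
    have hc1 : n.choose (k + 1) = 1 := by rw [hkn, Nat.choose_self]
    omega
  · rw [if_neg hkn] at hXmk1
    omega

end StructureSheaf

/-! ## §2 `h^k(N_D) = C(n,k+1)` for every `k`, from `0 → 𝒪_X → 𝒪_X(Θ) → N_D → 0` -/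

section NormalSheaf

variable {HX HXp HN : ℕ → Type*} [∀ k, AddCommGroup (HX k)] [∀ k, Module K (HX k)] [∀ k, FiniteDimensional K (HX k)]
  [∀ k, AddCommGroup (HXp k)] [∀ k, Module K (HXp k)] [∀ k, FiniteDimensional K (HXp k)]
  [∀ k, AddCommGroup (HN k)] [∀ k, Module K (HN k)] [∀ k, FiniteDimensional K (HN k)]

/-- **`h^k(N_D) = h^{k+1}(𝒪_X) = C(n,k+1)` for every `k`** (th-7 §B.3, second count; `h⁰(N_D) = n`). Carriers BY VALUE: `HX k`,
`HXp k`, `HN k` stand for `H^k(X, 𝒪_X)`, `H^k(X, 𝒪_X(Θ))`, `H^k(D, N_D)` (`N_D = 𝒪_D(D)`, `D` Cartier); `r k`, `s k`, `t k` for the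
maps of the cohomology sequence of `0 → 𝒪_X → 𝒪_X(Θ) → N_D → 0`, `r 0` injective (`h0`), exact at `HXp k`, `HN k`, `HX (k+1)`;
dimensions (V1) `dim HX k = C(n,k)`, (V2) `dim HXp k = [k = 0]`. Chase: `s k = 0` for all `k`, so `t k : HN k ≅ HX (k+1)`.
[cite: Lange2023AbelianVarietiesComplex, Thm. 1.1.21 (b), Cor. 1.6.5, Thm. 1.7.1] [cite: MumfordAV1970, §16] -/
theorem finrank_normalSheaf_eq_choose {n : ℕ} (r : ∀ k, HX k →ₗ[K] HXp k) (s : ∀ k, HXp k →ₗ[K] HN k)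
    (t : ∀ k, HN k →ₗ[K] HX (k + 1)) (h0 : LinearMap.ker (r 0) = ⊥)
    (hB : ∀ k, LinearMap.range (r k) = LinearMap.ker (s k)) (hC : ∀ k, LinearMap.range (s k) = LinearMap.ker (t k))
    (hA : ∀ k, LinearMap.range (t k) = LinearMap.ker (r (k + 1)))
    (hX : ∀ k, finrank K (HX k) = n.choose k) (hXp : ∀ k, finrank K (HXp k) = if k = 0 then 1 else 0) (k : ℕ) :
    finrank K (HN k) = n.choose (k + 1) := by
  have eB := finrank_eq_rank_add_rank_of_exact (r k) (s k) (hB k)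
  have eC := finrank_eq_rank_add_rank_of_exact (s k) (t k) (hC k)
  have eA := finrank_eq_rank_add_rank_of_exact (t k) (r (k + 1)) (hA k)
  have rr' : finrank K (LinearMap.range (r (k + 1))) ≤ finrank K (HXp (k + 1)) := Submodule.finrank_le _
  have hXpk := hXp k
  have hXpk1 := hXp (k + 1)
  have hXk1 := hX (k + 1)
  rw [if_neg (show k + 1 ≠ 0 by omega)] at hXpk1
  by_cases hk : k = 0
  · subst hk
    rw [if_pos rfl] at hXpk
    have rr : finrank K (LinearMap.range (r 0)) = finrank K (HX 0) :=
      LinearMap.finrank_range_of_inj (LinearMap.ker_eq_bot.mp h0)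
    have hX0 := hX 0
    rw [Nat.choose_zero_right] at hX0
    omega
  · rw [if_neg hk] at hXpk
    omega

end NormalSheaf

/-! ## §3 The local-to-global window: `dim Ext^k ≤ h^k(𝒪_D) + h^{k−1}(N_D)`, `Ext⁰ ≅ H⁰(𝒪_D)` -/

section LocalToGlobal

variable {HD E HN : ℕ → Type*} [∀ k, AddCommGroup (HD k)] [∀ k, Module K (HD k)] [∀ k, FiniteDimensional K (HD k)]
  [∀ k, AddCommGroup (E k)] [∀ k, Module K (E k)] [∀ k, FiniteDimensional K (E k)]
  [∀ k, AddCommGroup (HN k)] [∀ k, Module K (HN k)] [∀ k, FiniteDimensional K (HN k)]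

/-- **The local-to-global WINDOW in positive degrees: `dim Ext^{k+1}(i_*L, i_*L) ≤ h^{k+1}(𝒪_D) + h^k(N_D)`.** Carriers BY VALUE:
`HD k`, `E k`, `HN k` = `H^k(D, 𝒪_D) = H^k(X, 𝓔xt⁰)`, `Ext^k_X(i_*L, i_*L)`, `H^k(D, N_D) = H^k(X, 𝓔xt¹)`; `ι k : HD k → E k`,
`π k : E (k+1) → HN k` the edge maps of the two-row local-to-global spectral sequence (`L` invertible, `D` Cartier), exact AT
`E (k+1)` (`hE`) — the one exactness an upper bound uses. [cite: GortzWedhorn2023, Cor. 21.108] -/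
theorem finrank_ext_succ_le (ι : ∀ k, HD k →ₗ[K] E k) (π : ∀ k, E (k + 1) →ₗ[K] HN k)
    (hE : ∀ k, LinearMap.range (ι (k + 1)) = LinearMap.ker (π k)) (k : ℕ) :
    finrank K (E (k + 1)) ≤ finrank K (HD (k + 1)) + finrank K (HN k) :=
  finrank_mid_le_of_exact (ι (k + 1)) (π k) (hE k)

/-- **Degree `0`: `Ext⁰(i_*L, i_*L) = Hom ≅ H⁰(𝒪_D)`** — the edge map `ι 0 : H⁰(𝓔xt⁰) → Ext⁰` is injective with full range
(`H^{−1}(𝓔xt¹) = 0`), BY VALUE (`h0`, `h0'`). [cite: GortzWedhorn2023, Cor. 21.108] -/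
theorem finrank_ext_zero_eq (ι : ∀ k, HD k →ₗ[K] E k) (h0 : LinearMap.ker (ι 0) = ⊥) (h0' : LinearMap.range (ι 0) = ⊤) :
    finrank K (E 0) = finrank K (HD 0) :=
  finrank_eq_of_ker_eq_bot_of_range_eq_top (ι 0) h0 h0'

/-- **THE WINDOW FROM THE HODGE NUMBERS OF THE THETA DIVISOR, every `n ≥ 1`, every `k`:** if `h^k(𝒪_D) = [k < n]·C(n,k)` (§1 with
(V4)) and `h^k(N_D) = C(n,k+1)` (§2) — here BY VALUE as numbers — then along the local-to-global sequence
`dim Ext^k(i_*L, i_*L) ≤ r_k(n) = transversePairRank n k = [t^k]P_n` for every `k`. [cite: GortzWedhorn2023, Cor. 21.108] -/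
theorem finrank_ext_le_transversePairRank_of_hodgeNumbers {n : ℕ} (hn : 1 ≤ n) (ι : ∀ k, HD k →ₗ[K] E k)
    (π : ∀ k, E (k + 1) →ₗ[K] HN k) (h0 : LinearMap.ker (ι 0) = ⊥) (h0' : LinearMap.range (ι 0) = ⊤)
    (hE : ∀ k, LinearMap.range (ι (k + 1)) = LinearMap.ker (π k))
    (hD : ∀ k, finrank K (HD k) = if k < n then n.choose k else 0) (hN : ∀ k, finrank K (HN k) = n.choose (k + 1))
    (k : ℕ) : finrank K (E k) ≤ transversePairRank n k := by
  rw [transversePairRank_eq_structure_add_normal]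
  cases k with
  | zero =>
    rw [finrank_ext_zero_eq ι h0 h0', hD 0, if_pos (show 0 < n by omega)]
    exact Nat.le_add_right _ _
  | succ j =>
    have h := finrank_ext_succ_le ι π hE j
    rw [hD (j + 1), hN j] at h
    rw [if_neg (show j + 1 ≠ 0 by omega)]
    exact h

/-- **… `= [t^k]P_n(t)`**: the same bound against seat p10's polynomial `P_n = 2(1+t)ⁿ − 1 − tⁿ` (STRUCTURE §1.0 D8), cast to `ℤ`.
[bookkeeping] -/
theorem finrank_ext_le_coeff_P_of_hodgeNumbers {n : ℕ} (hn : 1 ≤ n) (ι : ∀ k, HD k →ₗ[K] E k)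
    (π : ∀ k, E (k + 1) →ₗ[K] HN k) (h0 : LinearMap.ker (ι 0) = ⊥) (h0' : LinearMap.range (ι 0) = ⊤)
    (hE : ∀ k, LinearMap.range (ι (k + 1)) = LinearMap.ker (π k))
    (hD : ∀ k, finrank K (HD k) = if k < n then n.choose k else 0) (hN : ∀ k, finrank K (HN k) = n.choose (k + 1))
    (k : ℕ) : (finrank K (E k) : ℤ) ≤ (P n).coeff k := by
  rw [coeff_P]
  exact_mod_cast finrank_ext_le_transversePairRank_of_hodgeNumbers hn ι π h0 h0' hE hD hN k

/-- **`Ext⁰ = Hom(i_*L, i_*L)` is a line and `Ext^k = 0` for `k > n`** along the same data (`r₀(n) = 1`, `r_k(n) = 0` for `k > n`;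
in degree `0` this is the equality `ι 0 : H⁰(𝒪_D) ≅ Ext⁰`, `h⁰(𝒪_D) = 1`). [bookkeeping] -/
theorem finrank_ext_zero_and_vanishing_of_hodgeNumbers {n : ℕ} (hn : 1 ≤ n) (ι : ∀ k, HD k →ₗ[K] E k)
    (π : ∀ k, E (k + 1) →ₗ[K] HN k) (h0 : LinearMap.ker (ι 0) = ⊥) (h0' : LinearMap.range (ι 0) = ⊤)
    (hE : ∀ k, LinearMap.range (ι (k + 1)) = LinearMap.ker (π k))
    (hD : ∀ k, finrank K (HD k) = if k < n then n.choose k else 0) (hN : ∀ k, finrank K (HN k) = n.choose (k + 1)) :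
    finrank K (E 0) = 1 ∧ ∀ k, n < k → finrank K (E k) = 0 := by
  refine ⟨?_, fun k hk ↦ ?_⟩
  · rw [finrank_ext_zero_eq ι h0 h0', hD 0, if_pos (show 0 < n by omega), Nat.choose_zero_right]
  · have h := finrank_ext_le_transversePairRank_of_hodgeNumbers hn ι π h0 h0' hE hD hN k
    rw [transversePairRank_eq_structure_add_normal, if_neg (show ¬ k < n by omega), if_neg (show k ≠ 0 by omega),
      Nat.choose_eq_zero_of_lt hk] at h
    omega

end LocalToGlobal

/-! ## §4 THE THETA-DIVISOR PROFILE (th-7 §B.3), assembled from the three sequences -/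

section Profile

variable {HXm HX HD HXp HN E : ℕ → Type*}
  [∀ k, AddCommGroup (HXm k)] [∀ k, Module K (HXm k)] [∀ k, FiniteDimensional K (HXm k)]
  [∀ k, AddCommGroup (HX k)] [∀ k, Module K (HX k)] [∀ k, FiniteDimensional K (HX k)]
  [∀ k, AddCommGroup (HD k)] [∀ k, Module K (HD k)] [∀ k, FiniteDimensional K (HD k)]
  [∀ k, AddCommGroup (HXp k)] [∀ k, Module K (HXp k)] [∀ k, FiniteDimensional K (HXp k)]
  [∀ k, AddCommGroup (HN k)] [∀ k, Module K (HN k)] [∀ k, FiniteDimensional K (HN k)]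
  [∀ k, AddCommGroup (E k)] [∀ k, Module K (E k)] [∀ k, FiniteDimensional K (E k)]

/-- **`h^k(𝒪_D) = [k < n]·C(n,k)` for EVERY `k`** (§1 below `n`, (V4) from `n` on). [bookkeeping] -/
theorem finrank_structureSheaf_eq {n : ℕ} (a : ∀ k, HXm k →ₗ[K] HX k) (b : ∀ k, HX k →ₗ[K] HD k)
    (c : ∀ k, HD k →ₗ[K] HXm (k + 1)) (hB : ∀ k, LinearMap.range (a k) = LinearMap.ker (b k))
    (hC : ∀ k, LinearMap.range (b k) = LinearMap.ker (c k)) (hA : ∀ k, LinearMap.range (c k) = LinearMap.ker (a (k + 1)))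
    (hXm : ∀ k, finrank K (HXm k) = if k = n then 1 else 0) (hX : ∀ k, finrank K (HX k) = n.choose k)
    (hDtop : ∀ k, n ≤ k → finrank K (HD k) = 0) (k : ℕ) :
    finrank K (HD k) = if k < n then n.choose k else 0 := by
  split_ifs with hk
  · exact finrank_structureSheaf_eq_choose a b c hB hC hA hXm hX hDtop hk
  · exact hDtop k (by omega)

/-- **B.3 PROPOSITION (the theta-divisor profile, every `n ≥ 1`, every `k`) — `dim Ext^k_X(i_*L, i_*L) ≤ r_k(n) = [t^k]P_n(t)`.**
ALL INPUTS BY VALUE. Carriers: `HXm k`, `HX k`, `HXp k` = `H^k` of `𝒪_X(−Θ)`, `𝒪_X`, `𝒪_X(Θ)` on a p.p. abelian `n`-fold `(X, Θ)`;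
`HD k`, `HN k` = `H^k(D, 𝒪_D)`, `H^k(D, N_D)` of a theta divisor `D ∈ |Θ|` (Cartier, `h⁰(𝒪_X(Θ)) = 1`; smoothness NOT used); `E k` =
`Ext^k_X(i_*L, i_*L)`, `L` invertible on `D` (the cell: `𝓕_m = i_*𝒪_D(m·C_p)` on `X = J(C)`, `n = 3`). Maps: `a, b, c` (E1), `r, s, t`
(E2) exact where stated, `r 0` injective; `ι, π` (E3), `ι 0` bijective, exactness at `E (k+1)`. Dimensions (V1)–(V4). CONCLUSION:
`dim E k ≤ transversePairRank n k` — the FACTOR WINDOW of `MethodInstanceG6ExtremalFactors.lean` §1 (`(1, 2n, n(n−1), …)`; `(1, 6, 6, 1)`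
at `n = 3`), every `k` at once (`Ext⁰` a line / `Ext^k = 0` beyond `n` / the `[t^k]P_n` form: §3's `…_of_hodgeNumbers` corollaries fed
with `finrank_structureSheaf_eq` and `finrank_normalSheaf_eq_choose`).
[cite: Lange2023AbelianVarietiesComplex, Thm. 1.1.21 (b), Cor. 1.6.5, Thm. 1.7.1 and Thm. 1.7.3] [cite: MumfordAV1970, §16]
[cite: GortzWedhorn2023, Thm. 21.57 and Cor. 21.108]
[cite: Markman2025SecantWeil, Lemma 8.3.2 (preprint; the profile `(1,6,6,1)` at `n = 3`)] -/
theorem finrank_ext_le_transversePairRank {n : ℕ} (hn : 1 ≤ n)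
    -- (E1) `0 → 𝒪_X(−Θ) → 𝒪_X → 𝒪_D → 0`
    (a : ∀ k, HXm k →ₗ[K] HX k) (b : ∀ k, HX k →ₗ[K] HD k) (c : ∀ k, HD k →ₗ[K] HXm (k + 1))
    (hB : ∀ k, LinearMap.range (a k) = LinearMap.ker (b k)) (hC : ∀ k, LinearMap.range (b k) = LinearMap.ker (c k))
    (hA : ∀ k, LinearMap.range (c k) = LinearMap.ker (a (k + 1)))
    -- (E2) `0 → 𝒪_X → 𝒪_X(Θ) → N_D → 0`
    (r : ∀ k, HX k →ₗ[K] HXp k) (s : ∀ k, HXp k →ₗ[K] HN k) (t : ∀ k, HN k →ₗ[K] HX (k + 1))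
    (h0 : LinearMap.ker (r 0) = ⊥) (hB' : ∀ k, LinearMap.range (r k) = LinearMap.ker (s k))
    (hC' : ∀ k, LinearMap.range (s k) = LinearMap.ker (t k)) (hA' : ∀ k, LinearMap.range (t k) = LinearMap.ker (r (k + 1)))
    -- (E3) local-to-global edge maps
    (ι : ∀ k, HD k →ₗ[K] E k) (π : ∀ k, E (k + 1) →ₗ[K] HN k) (hι : LinearMap.ker (ι 0) = ⊥)
    (hι' : LinearMap.range (ι 0) = ⊤) (hE : ∀ k, LinearMap.range (ι (k + 1)) = LinearMap.ker (π k))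
    -- (V1)–(V4)
    (hX : ∀ k, finrank K (HX k) = n.choose k) (hXp : ∀ k, finrank K (HXp k) = if k = 0 then 1 else 0)
    (hXm : ∀ k, finrank K (HXm k) = if k = n then 1 else 0) (hDtop : ∀ k, n ≤ k → finrank K (HD k) = 0) (k : ℕ) :
    finrank K (E k) ≤ transversePairRank n k :=
  finrank_ext_le_transversePairRank_of_hodgeNumbers hn ι π hι hι' hE
    (finrank_structureSheaf_eq a b c hB hC hA hXm hX hDtop)
    (finrank_normalSheaf_eq_choose r s t h0 hB' hC' hA' hX hXp) k

end Profile

/-! ## §5 The numerals of record: `n = 3` (g = 6, rows D-2…D-6), `n = 2` (g = 4 anchor), and the Künneth box `48` -/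

/-- `n = 3` (a theta divisor `D = Θ = C^{(2)}` in a p.p. abelian THREEFOLD): the chase gives `h^•(𝒪_D) = (1, 3, 3)`, `h^•(N_D) =
(3, 3, 1)`, window `(1, 3+3, 3+3, 0+1) = (1, 6, 6, 1) = (r_k(3))_k` — the census cells «`dim Ext^•(𝓕_m,𝓕_m) ≤ (1, 3+3, 3+3, 1)`» of
D-2…D-6 and [Markman2025SecantWeil] Lemma 8.3.2's `(1,6,6,1)`. [bookkeeping] -/
theorem window_three :
    (List.range 5).map (fun k ↦ if k < 3 then (3 : ℕ).choose k else 0) = [1, 3, 3, 0, 0] ∧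
    (List.range 4).map (fun k ↦ (3 : ℕ).choose (k + 1)) = [3, 3, 1, 0] ∧
    (List.range 5).map (fun k ↦ (if k < 3 then (3 : ℕ).choose k else 0) + (if k = 0 then 0 else (3 : ℕ).choose k)) =
      [1, 6, 6, 1, 0] ∧
    (List.range 5).map (transversePairRank 3) = [1, 6, 6, 1, 0] := by decide

/-- `n = 2` (a genus-2 curve `D = Θ` in a p.p. abelian SURFACE): `h^•(𝒪_D) = (1, 2)`, `h^•(N_D) = (2, 1)`, window `(1, 2+2, 0+1) =
(1, 4, 1) = (r_k(2))_k` — «the SAME polynomial as `I_p`» at the g = 4 anchor (`MethodInstanceG6ExtremalFactors.kunneth_two_two`). [bookkeeping] -/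
theorem window_two :
    (List.range 4).map (fun k ↦ (if k < 2 then (2 : ℕ).choose k else 0) + (if k = 0 then 0 else (2 : ℕ).choose k)) =
      [1, 4, 1, 0] ∧
    (List.range 4).map (transversePairRank 2) = [1, 4, 1, 0] := by decide

section Box

variable {E₁ E₂ G : ℕ → Type*} [∀ k, AddCommGroup (E₁ k)] [∀ k, Module K (E₁ k)]
  [∀ k, AddCommGroup (E₂ k)] [∀ k, Module K (E₂ k)] [∀ k, AddCommGroup (G k)] [∀ k, Module K (G k)]

/-- **TWO theta-divisor factors in the window ⟹ the BOX is under the rank door's number: `dim Ext^k(F₁ ⊠ F₂) ≤ R_k(n) = boxRank n k`**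
(`≤ 1·6 + 6·6 + 6·1 = 48` at `n = 3`, `k = 2`: the OBJECT side of «rank 48 = bound 48», rows D-2…D-6). `E₁ k`, `E₂ k` = `Ext^k(F_j,F_j)`
of the factors (each under its window by §4; for the cell `F₁ = 𝓕_m^∨`, `F₂ = 𝓕_m` on `X = J(C)`), `G k` = `Ext^k(F₁ ⊠ F₂, F₁ ⊠ F₂)`,
with the KÜNNETH identity in degree `k` BY VALUE as a number identity (`hK`), as in the predecessor's `extRank_le_boxRank_of_kunneth_of_window`.
[cite: Markman2025SecantWeil, §8.4 (the Künneth decomposition between (8.4.1) and (8.4.2); preprint)] -/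
theorem finrank_box_le_boxRank {n k : ℕ} (hF₁ : ∀ i, finrank K (E₁ i) ≤ transversePairRank n i)
    (hF₂ : ∀ j, finrank K (E₂ j) ≤ transversePairRank n j)
    (hK : finrank K (G k) = ∑ ij ∈ antidiagonal k, finrank K (E₁ ij.1) * finrank K (E₂ ij.2)) :
    finrank K (G k) ≤ boxRank n k := by
  rw [hK, boxRank]
  exact Finset.sum_le_sum fun ij _ ↦ Nat.mul_le_mul (hF₁ ij.1) (hF₂ ij.2)

/-- The g = 6 numeral: two factors in the `n = 3` window give `dim Ext²(F₁ ⊠ F₂) ≤ boxRank 3 2 = 48` («E₂ UPPER bound ≤ 48», D-2). [bookkeeping] -/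
theorem finrank_box_le_48 (hF₁ : ∀ i, finrank K (E₁ i) ≤ transversePairRank 3 i)
    (hF₂ : ∀ j, finrank K (E₂ j) ≤ transversePairRank 3 j)
    (hK : finrank K (G 2) = ∑ ij ∈ antidiagonal 2, finrank K (E₁ ij.1) * finrank K (E₂ ij.2)) :
    finrank K (G 2) ≤ 48 := by
  have h := finrank_box_le_boxRank hF₁ hF₂ hK
  have h48 : boxRank 3 2 = 48 := by decide
  omega

end Box

end Cohomology

end ThetaDivisorWindow
end Summit.Ventures.HSemireg
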